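import Summits.NavierStokesRegularity.NavierStokesRegularity.Theorems.ScenarioCensusForward
import Summits.NavierStokesRegularity.NavierStokesRegularity.Theorems.TypeILiouvilleTypeIliouvilleNoTypeIITypeIIZoomPackage
import HarnessLib

/-!
# Census row F7vt (uniformly vanishing top) — part 1/2: the criterion, the split of row F7, hot-spot
# saturation (statement) and the value-active windows of a blow-up

Re-homing (VERBATIM port, namespace adapted) of ns-idea-3's LINE 7 «vanishing-top»
(`pub/ideators/ns-idea-3/lines/vanishing-top/line-vanishing-top.lean`, sha16 `4908090d8b1f630c`, 540 l.,
rc 0, 0 sorry) ordered by the census lead (ns-census-lead g6, 2026-08-28T14:34Z) for the scenario census of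
`NavierStokesRegularity` (cell `pub/ns-census`), typer seat `ns-census-typer-2` (generation 7).

Row F7 of the census («`u ∈ L^∞_t L^{3,∞}_x`, LARGE weak-`L³` norm, no symmetry»,
`ScenarioCensus.Row_F7`) is OPEN.  The line splits off a NON-EQUIVALENT criterion decided in kernel:
* `Row_F7vt` — a Clay solution (classical on `[0,T)`, Leray–Hopf from a rapidly decaying datum) whose
  viscosity-normalised field `ũ = timeRescale ν⁻¹ ν⁻¹ u` has UNIFORMLY VANISHING TOP on a final slab,
  `sup_{s∈(S₁,νT)} sup_{t≥Λ} t³|{|ũ(s)|>t}| → 0` as `Λ → ∞` (`HasVanishingTop`), extends smoothly past `T`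
  — PROVED in part 2 (`rowF7vt_holds`); no bound on the weak-`L³` quasinorm is assumed;
* `TopTameness` — the residual, stated in the maximal frame so that it is EXACTLY row F7
  (`topTameness_iff_rowF7`, part 2);
* `HotSpotSaturation` — every blow-up saturates its top (proved in part 2 from the windows of this file,
  the hot ball of KNSS 2009 Prop. 4.1 and the scale invariance of the top mass).
This part: §0 the top functional, §1 the split `Row_F7 ⇐ Row_F7vt ∧ TopTameness`, §2 the saturation
statement and `Row_F7vt ⇐ HotSpotSaturation`, §3a value-active sup-controlled windows of ANY blow-up at
arbitrarily high level (Type I: Leray's rate + the Type-I bound; Type II: the tree's PQS windows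
`TypeIIZoom.exists_valueActiveWindow`).  Census keys are in part 2 (`ScenarioCensusRowF7vt.lean`).

Values are booked by the census lead, not by this file; NS regularity is NOT proved; no summit statement
is proved by this file.

## References

* G. Koch, N. Nadirashvili, G. Seregin, V. Šverák, Acta Math. 203 (2009) = arXiv:0709.3599, §4 Prop. 4.1,
  §6 proof of Prop. 6.1. [KochNadirashviliSereginSverak2009]
* J. Leray, Acta Math. 63 (1934), §19 (3.9) (the lower blow-up rate). [Leray1934]
-/

set_option linter.dupNamespace false

noncomputable section

open MeasureTheory Set Filter Topology Function Metric
open scoped ENNReal NNReal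

namespace Summit.NavierStokesRegularity.NavierStokesRegularity.Theorems.ScenarioCensus.VanishingTop

open Literature.Analysis Literature.Analysis.FluidPDE Literature.Analysis.FunctionSpaces
open Summit.NavierStokesRegularity.NavierStokesRegularity.Theorems.ScenarioCensus (Row_F7)
open Summit.NavierStokesRegularity.NavierStokesRegularity.Theorems.TypeIliouvilleNoTypeII.ImmortalZoom
open Summit.NavierStokesRegularity.NavierStokesRegularity.Theorems.TypeIliouvilleNoTypeII.TypeIIZoom

/-- `ℝ³`. -/
abbrev E3 : Type := EuclideanSpace ℝ (Fin 3)

/-! ## §0 The top functional and the criterion -/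

/-- **Top mass at level `t`** of a field `f : ℝ³ → ℝ³`: `t³ · |{x : t < |f x|}|` — the summand of the
weak-`L³` quasinorm `eWeakLpPow f 3 volume = sup_t t³ |{|f| > t}|`. [folklore] -/
def topMass (f : E3 → E3) (t : ℝ≥0) : ℝ≥0∞ :=
  (t : ℝ≥0∞) ^ 3 * volume {x | (t : ℝ≥0∞) < ‖f x‖ₑ}

/-- **Uniformly vanishing top on a slab**: `sup_{s ∈ (S₁,S₂)} sup_{t ≥ Λ} t³|{|w s| > t}| → 0` as
`Λ → ∞` (uniform integrability of the distribution functions AT THE TOP; for ONE weak-`L³` function the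
top mass is merely bounded, and for one `L³` function it tends to `0`). -/
def HasVanishingTop (w : ℝ → E3 → E3) (S₁ S₂ : ℝ) : Prop :=
  ∀ ε : ℝ≥0∞, 0 < ε → ∃ Λ : ℝ≥0, ∀ s ∈ Ioo S₁ S₂, ∀ t : ℝ≥0, Λ ≤ t → topMass (w s) t ≤ ε

/-! ## §1 The split `Row_F7 ⇐ Row_F7vt ∧ TopTameness` -/

/-- **Obligation VT = census criterion row F7vt (NEW, non-equivalent to F7)**: in the Clay frame of the
forward table (classical on `[0,T)`, Leray–Hopf from a rapidly decaying datum), if the viscosity-normalised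
field `ũ = timeRescale ν⁻¹ ν⁻¹ u` has UNIFORMLY VANISHING TOP on a final slab `(S₁, νT)`, the solution
extends smoothly past `T`.  NO bound on the weak-`L³` quasinorm is assumed (the bottom of the distribution
function is free), so F7vt ⊄ F7; conversely a weak-`L³`-bounded blow-up saturates its top (§2), so
F7 ∩ F7vt ⊊ F7: the two rows are TRANSVERSAL.  PROVED below from §2 (`rowF7vt_of_hotSpot`) and §3. -/
def Row_F7vt : Prop :=
  ∀ (ν T : ℝ), 0 < ν → 0 < T →
    ∀ (u : ℝ → E3 → E3) (p : ℝ → E3 → ℝ),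
      IsClassicalNSSolutionOn (Ico 0 T) ν 0 u p → IsLerayHopfOn T ν 0 (u 0) u →
      HasRapidSpatialDecay (u 0) →
      ∀ S₁ : ℝ, 0 ≤ S₁ → S₁ < ν * T →
        HasVanishingTop (timeRescale ν⁻¹ ν⁻¹ u) S₁ (ν * T) → HasSmoothExtensionPast ν 0 u T

/-- **Obligation TT = the residual, stated in the MAXIMAL frame so that it is EXACTLY row F7**
(`topTameness_iff_rowF7`, kernel): a blow-up (maximal smooth solution, Leray–Hopf from a decaying datum)
whose normalised field is bounded in weak-`L³` on a final slab has uniformly vanishing top on some final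
slab.  By §2 NO blow-up has vanishing top, so TT says «there is no weak-`L³`-bounded blow-up» — all the
depth of F7 (ESS / Phuc backward uniqueness) sits here, now phrased as a statement about the TOP of the
distribution function only: «an `L^∞_t L^{3,∞}_x` blow-up cannot afford its (automatic) saturated top».
Instrument row that would refute it: any weak-`L³`-bounded blow-up (F7 / D-table DSS rows). [conjecture] -/
def TopTameness : Prop :=
  ∀ (ν T : ℝ), 0 < ν → 0 < T →
    ∀ (u : ℝ → E3 → E3) (p : ℝ → E3 → ℝ),
      IsMaximalSmoothSolution ν 0 u p T → IsLerayHopfOn T ν 0 (u 0) u →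
      HasRapidSpatialDecay (u 0) →
      ∀ (S₁ : ℝ) (W : ℝ≥0∞), 0 ≤ S₁ → S₁ < ν * T → W ≠ ⊤ →
        (∀ s ∈ Ioo S₁ (ν * T), eWeakLpPow (timeRescale ν⁻¹ ν⁻¹ u s) 3 volume ≤ W) →
        ∃ S₂ : ℝ, S₁ ≤ S₂ ∧ S₂ < ν * T ∧ HasVanishingTop (timeRescale ν⁻¹ ν⁻¹ u) S₂ (ν * T)

/-- **Composition (kernel)**: `Row_F7vt → TopTameness → Row_F7`. -/
theorem rowF7_of (hVT : Row_F7vt) (hTT : TopTameness) : Row_F7 := by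
  intro ν T hν hT u p hsol hLH hdec S₁ W hS₁ hS₁T hW hbd
  by_contra hext
  have hmax : IsMaximalSmoothSolution ν 0 u p T := ⟨hsol, hext⟩
  obtain ⟨S₂, h12, h2T, htop⟩ := hTT ν T hν hT u p hmax hLH hdec S₁ W hS₁ hS₁T hW hbd
  exact hext (hVT ν T hν hT u p hsol hLH hdec S₂ (hS₁.trans h12) h2T htop)

/-- **The residual is implied by the row** (kernel): `Row_F7 → TopTameness` (a weak-`L³`-bounded blow-up
contradicts F7 outright). -/
theorem topTameness_of_rowF7 (h : Row_F7) : TopTameness := by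
  intro ν T hν hT u p hmax hLH hdec S₁ W hS₁ hS₁T hW hbd
  exact absurd (h ν T hν hT u p hmax.1 hLH hdec S₁ W hS₁ hS₁T hW hbd) hmax.2

/-! ## §2 The structural key lemma: blow-ups SATURATE the top (hot spots of record windows) -/

/-- **Obligation S = hot-spot saturation** (PROVED in §3): a MAXIMAL smooth solution (lifespan `T`,
Leray–Hopf from a decaying datum) carries, arbitrarily close to `T` and at arbitrarily HIGH levels, top
mass `≥ c > 0` in its normalised field: around a value-active sup-controlled window (PQS time doubling for
Type II, Leray + the Type-I rate for Type I) the unit zoom is a bounded mild solution with `|w(0,0)| ≥ 1/(2A)`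
and a uniform gradient bound (KNSS 2009 Prop. 4.1), hence `|w(0,·)| > 1/(4A)` on a ball of FIXED radius,
and the top mass is scale invariant. -/
def HotSpotSaturation : Prop :=
  ∀ (ν T : ℝ), 0 < ν → 0 < T →
    ∀ (u : ℝ → E3 → E3) (p : ℝ → E3 → ℝ),
      IsMaximalSmoothSolution ν 0 u p T → IsLerayHopfOn T ν 0 (u 0) u → HasRapidSpatialDecay (u 0) →
      ∃ c : ℝ≥0∞, 0 < c ∧ ∀ (Λ : ℝ≥0) (a : ℝ), a < ν * T →
        ∃ s ∈ Ioo a (ν * T), ∃ t : ℝ≥0, Λ ≤ t ∧ c ≤ topMass (timeRescale ν⁻¹ ν⁻¹ u s) t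

/-- **Composition (kernel)**: hot-spot saturation ⇒ the vanishing-top criterion. -/
theorem rowF7vt_of_hotSpot (hS : HotSpotSaturation) : Row_F7vt := by
  intro ν T hν hT u p hsol hLH hdec S₁ hS₁ hS₁T htop
  by_contra hext
  have hmax : IsMaximalSmoothSolution ν 0 u p T := ⟨hsol, hext⟩
  obtain ⟨c, hc0, hsat⟩ := hS ν T hν hT u p hmax hLH hdec
  -- a positive finite level strictly below `c`
  set c' : ℝ≥0∞ := min c 1 with hc'
  have hc'0 : c' ≠ 0 := (lt_min hc0 one_pos).ne'
  have hc'top : c' ≠ ⊤ := ne_top_of_le_ne_top ENNReal.one_ne_top (min_le_right _ _)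
  have hεc : c' / 2 < c := (ENNReal.half_lt_self hc'0 hc'top).trans_le (min_le_left _ _)
  obtain ⟨Λ, hΛ⟩ := htop (c' / 2) (ENNReal.half_pos hc'0)
  obtain ⟨s, hs, t, hΛt, hct⟩ := hsat Λ S₁ hS₁T
  exact absurd ((hct.trans (hΛ s hs t hΛt)).trans_lt hεc) (lt_irrefl c)


/-! ## §3 Proof of hot-spot saturation

### §3a Value-active sup-controlled windows of ANY blow-up, at arbitrarily high level -/

section Windows

variable {ν T : ℝ} {u : ℝ → E3 → E3} {p : ℝ → E3 → ℝ}

/-- The sup over `x` is controlled by any uniform bound (near-attainment of the modulus). [folklore] -/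
theorem modulus_le_of_bound {m : ℝ → ℝ} {t B : ℝ}
    (hnear : ∀ ε : ℝ, 0 < ε → ∃ x : E3, m t - ε < ‖u t x‖) (hB : ∀ x, ‖u t x‖ ≤ B) : m t ≤ B := by
  by_contra h
  push Not at h
  obtain ⟨x, hx⟩ := hnear (m t - B) (by linarith)
  linarith [hB x]

/-- **Windows, Type-I branch**: if the blow-up is Type I, Leray's lower bound `m(t) ≥ c/√(T-t)` makes the
natural window `[t - K₀ν/m(t)², t + K₀ν/m(t)²]`, `K₀ = c²/(2ν)`, lie inside `[t - (T-t)/2, t + (T-t)/2]`,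
on which the Type-I bound gives `|u| ≤ (√2 C / c)·m(t)`. [cite: Leray1934, §19 (3.9)] -/
theorem exists_window_typeI (hν : 0 < ν) (hT : 0 < T) (hmax : IsMaximalSmoothSolution ν 0 u p T)
    (hLH : IsLerayHopfOn T ν 0 (u 0) u) (hdec : HasRapidSpatialDecay (u 0)) (hI : IsTypeIBlowup u T) :
    ∃ A K₀ : ℝ, 1 ≤ A ∧ 0 < K₀ ∧ ∀ a : ℝ, 0 ≤ a → a < T →
      ∃ t M : ℝ, ∃ x₀ : E3, 0 < M ∧
        Icc (t - K₀ * ν / M ^ 2) (t + K₀ * ν / M ^ 2) ⊆ Ioo a T ∧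
        (∀ s ∈ Icc (t - K₀ * ν / M ^ 2) (t + K₀ * ν / M ^ 2), ∀ x, ‖u s x‖ ≤ A * M) ∧
        M ≤ 2 * ‖u t x₀‖ := by
  obtain ⟨m, -, hle, hnear, c, hc, hler⟩ := stub_supNorm ν T hν hT u p hmax hLH hdec
  obtain ⟨C, hC⟩ := hI
  obtain ⟨T₀, hT₀T, hT₀⟩ := mem_nhdsLT_iff_exists_Ioo_subset.1 hC
  set C' : ℝ := max C 0 with hC'def
  have hC'0 : 0 ≤ C' := le_max_right _ _
  refine ⟨max 1 (Real.sqrt 2 * C' / c), c ^ 2 / (2 * ν), le_max_left _ _, by positivity, ?_⟩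
  intro a ha0 haT
  -- centre `t` half way between `a' = max a T₀` and `T`
  set a' : ℝ := max a T₀ with ha'def
  have ha'T : a' < T := max_lt haT hT₀T
  set t : ℝ := (a' + T) / 2 with htdef
  have hta' : a' < t := by rw [htdef]; linarith
  have htT : t < T := by rw [htdef]; linarith
  have ht0 : 0 ≤ t := (ha0.trans (le_max_left _ _)).trans hta'.le
  have htI : t ∈ Ico 0 T := ⟨ht0, htT⟩
  have hTt : 0 < T - t := by linarith
  -- level `M = m t ≥ c / √(T - t) > 0`
  set M : ℝ := m t with hMdef
  have hsq : 0 < Real.sqrt (T - t) := Real.sqrt_pos.2 hTt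
  have hcM : c / Real.sqrt (T - t) ≤ M := hler t htI
  have hM : 0 < M := lt_of_lt_of_le (div_pos hc hsq) hcM
  -- half-length `h = K₀ν/M² ≤ (T - t)/2`
  have hh : c ^ 2 / (2 * ν) * ν / M ^ 2 ≤ (T - t) / 2 := by
    have h1 : c ^ 2 / (T - t) ≤ M ^ 2 := by
      have e : (c / Real.sqrt (T - t)) ^ 2 = c ^ 2 / (T - t) := by
        rw [div_pow, Real.sq_sqrt hTt.le]
      rw [← e]
      exact pow_le_pow_left₀ (div_pos hc hsq).le hcM 2
    have h2 : c ^ 2 / (2 * ν) * ν / M ^ 2 = c ^ 2 / M ^ 2 / 2 := by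
      field_simp
    rw [h2]
    have h3 : c ^ 2 / M ^ 2 ≤ T - t := by
      rw [div_le_iff₀ (by positivity)]
      have := (div_le_iff₀ hTt).1 h1
      linarith
    linarith
  have hh0 : 0 ≤ c ^ 2 / (2 * ν) * ν / M ^ 2 := by positivity
  -- the window lies in `(a', T) ⊆ (a, T) ∩ (T₀, T)`
  have hwin : Icc (t - c ^ 2 / (2 * ν) * ν / M ^ 2) (t + c ^ 2 / (2 * ν) * ν / M ^ 2) ⊆ Ioo a' T := by
    intro s hs
    constructor
    · have : a' < t - (T - t) / 2 := by rw [htdef]; linarith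
      linarith [hs.1]
    · linarith [hs.2]
  refine ⟨t, M, ?_⟩
  -- value-active centre
  obtain ⟨x₀, hx₀⟩ := hnear t htI (M / 2) (by positivity)
  refine ⟨x₀, hM, hwin.trans (Ioo_subset_Ioo_left (le_max_left _ _)), ?_, by linarith⟩
  intro s hs x
  have hs' := hwin hs
  have hsT₀ : s ∈ Ioo T₀ T := ⟨(le_max_right a T₀).trans_lt hs'.1, hs'.2⟩
  have hTs : (T - t) / 2 ≤ T - s := by
    have : s ≤ t + (T - t) / 2 := hs.2.trans (by linarith)
    linarith
  have hTs0 : 0 < T - s := by linarith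
  have hus : ‖u s x‖ ≤ C / Real.sqrt (T - s) := hT₀ hsT₀ x
  have hsqs : 0 < Real.sqrt (T - s) := Real.sqrt_pos.2 hTs0
  -- `C/√(T-s) ≤ C'/√(T-s) ≤ C' √2/√(T-t) ≤ (√2 C'/c) M`
  have h1 : C / Real.sqrt (T - s) ≤ C' / Real.sqrt (T - s) :=
    div_le_div_of_nonneg_right (le_max_left _ _) hsqs.le
  have h2 : Real.sqrt (T - t) ≤ Real.sqrt 2 * Real.sqrt (T - s) := by
    rw [← Real.sqrt_mul (by norm_num : (0:ℝ) ≤ 2)]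
    exact Real.sqrt_le_sqrt (by linarith)
  have h3 : C' / Real.sqrt (T - s) ≤ Real.sqrt 2 * C' / Real.sqrt (T - t) := by
    rw [div_le_div_iff₀ hsqs hsq]
    calc C' * Real.sqrt (T - t) ≤ C' * (Real.sqrt 2 * Real.sqrt (T - s)) :=
          mul_le_mul_of_nonneg_left h2 hC'0
      _ = Real.sqrt 2 * C' * Real.sqrt (T - s) := by ring
  have h4 : Real.sqrt 2 * C' / Real.sqrt (T - t) ≤ Real.sqrt 2 * C' / c * M := by
    have e : Real.sqrt 2 * C' / c * M = Real.sqrt 2 * C' * (M / c) := by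
      field_simp
    rw [e, div_eq_mul_inv]
    refine mul_le_mul_of_nonneg_left ?_ (by positivity)
    rw [inv_le_iff_one_le_mul₀ hsq, div_mul_eq_mul_div, one_le_div hc]
    calc c = c / Real.sqrt (T - t) * Real.sqrt (T - t) := by field_simp
      _ ≤ M * Real.sqrt (T - t) := mul_le_mul_of_nonneg_right hcM hsq.le
  calc ‖u s x‖ ≤ Real.sqrt 2 * C' / c * M := hus.trans (h1.trans (h3.trans h4))
    _ ≤ max 1 (Real.sqrt 2 * C' / c) * M := mul_le_mul_of_nonneg_right (le_max_right _ _) hM.le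

/-- **Windows of any blow-up** (Type-I branch above; Type-II branch = the tree's PQS windows
`TypeIIZoom.exists_valueActiveWindow`), upgraded to an arbitrarily HIGH level `M ≥ L` by Leray's lower
bound `c/√(T-t) ≤ m(t) ≤ A·M`. [cite: KochNadirashviliSereginSverak2009, §6 proof of Prop. 6.1 (arXiv:0709.3599 p. 11)] -/
theorem exists_activeWindow (hν : 0 < ν) (hT : 0 < T) (hmax : IsMaximalSmoothSolution ν 0 u p T)
    (hLH : IsLerayHopfOn T ν 0 (u 0) u) (hdec : HasRapidSpatialDecay (u 0)) :
    ∃ A K₀ : ℝ, 1 ≤ A ∧ 0 < K₀ ∧ ∀ L a : ℝ, 0 ≤ a → a < T →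
      ∃ t M : ℝ, ∃ x₀ : E3, L ≤ M ∧ 0 < M ∧
        Icc (t - K₀ * ν / M ^ 2) (t + K₀ * ν / M ^ 2) ⊆ Ioo a T ∧
        (∀ s ∈ Icc (t - K₀ * ν / M ^ 2) (t + K₀ * ν / M ^ 2), ∀ x, ‖u s x‖ ≤ A * M) ∧
        M ≤ 2 * ‖u t x₀‖ := by
  -- the two branches give windows at every `a`
  have core : ∃ A K₀ : ℝ, 1 ≤ A ∧ 0 < K₀ ∧ ∀ a : ℝ, 0 ≤ a → a < T →
      ∃ t M : ℝ, ∃ x₀ : E3, 0 < M ∧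
        Icc (t - K₀ * ν / M ^ 2) (t + K₀ * ν / M ^ 2) ⊆ Ioo a T ∧
        (∀ s ∈ Icc (t - K₀ * ν / M ^ 2) (t + K₀ * ν / M ^ 2), ∀ x, ‖u s x‖ ≤ A * M) ∧
        M ≤ 2 * ‖u t x₀‖ := by
    by_cases hI : IsTypeIBlowup u T
    · exact exists_window_typeI hν hT hmax hLH hdec hI
    · refine ⟨2, 1, by norm_num, one_pos, fun a ha0 haT => ?_⟩
      obtain ⟨t, M, x₀, hM, hsub, hbd, hact⟩ :=
        exists_valueActiveWindow hν hT hmax hLH hdec hI 1 ha0 haT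
      exact ⟨t, M, x₀, hM, hsub, hbd, hact⟩
  obtain ⟨A, K₀, hA, hK₀, hwin⟩ := core
  obtain ⟨m, -, hle, hnear, c, hc, hler⟩ := stub_supNorm ν T hν hT u p hmax hLH hdec
  have hA0 : 0 < A := one_pos.trans_le hA
  refine ⟨A, K₀, hA, hK₀, fun L a ha0 haT => ?_⟩
  -- push `a` so close to `T` that Leray's bound forces `M ≥ L`
  set L' : ℝ := max L 1 with hL'def
  have hL' : 0 < L' := one_pos.trans_le (le_max_right _ _)
  set a' : ℝ := max a (T - (c / (A * L')) ^ 2) with ha'def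
  have ha'0 : 0 ≤ a' := ha0.trans (le_max_left _ _)
  have hsqpos : 0 < (c / (A * L')) ^ 2 := by positivity
  have ha'T : a' < T := max_lt haT (by linarith)
  obtain ⟨t, M, x₀, hM, hsub, hbd, hact⟩ := hwin a' ha'0 ha'T
  refine ⟨t, M, x₀, ?_, hM, hsub.trans (Ioo_subset_Ioo_left (le_max_left _ _)), hbd, hact⟩
  -- `t` lies in the window, hence in `(a', T)`
  have hh0 : 0 ≤ K₀ * ν / M ^ 2 := by positivity
  have htw : t ∈ Icc (t - K₀ * ν / M ^ 2) (t + K₀ * ν / M ^ 2) := ⟨by linarith, by linarith⟩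
  have ht : t ∈ Ioo a' T := hsub htw
  have htI : t ∈ Ico 0 T := ⟨ha'0.trans ht.1.le, ht.2⟩
  have hTt : 0 < T - t := by linarith [ht.2]
  -- `c/√(T-t) ≤ m t ≤ A M`
  have hmAM : m t ≤ A * M := modulus_le_of_bound (hnear t htI) (hbd t htw)
  have hcm : c / Real.sqrt (T - t) ≤ A * M := (hler t htI).trans hmAM
  -- `T - t < (c/(A L'))²`, so `√(T-t) < c/(A L')` and `L' < M`
  have hTt' : T - t < (c / (A * L')) ^ 2 := by
    have : T - (c / (A * L')) ^ 2 ≤ a' := le_max_right _ _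
    linarith [ht.1]
  have hsq : Real.sqrt (T - t) < c / (A * L') := by
    calc Real.sqrt (T - t) < Real.sqrt ((c / (A * L')) ^ 2) := Real.sqrt_lt_sqrt hTt.le hTt'
      _ = c / (A * L') := Real.sqrt_sq (by positivity)
  have hsq0 : 0 < Real.sqrt (T - t) := Real.sqrt_pos.2 hTt
  have hLM : L' ≤ M := by
    have h1 : A * L' < c / Real.sqrt (T - t) := by
      rw [lt_div_iff₀ hsq0]
      calc A * L' * Real.sqrt (T - t) < A * L' * (c / (A * L')) :=
            mul_lt_mul_of_pos_left hsq (by positivity)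
        _ = c := by field_simp
    have h2 : A * L' < A * M := h1.trans_le hcm
    exact (lt_of_mul_lt_mul_left h2 hA0.le).le
  exact (le_max_left _ _).trans hLM

end Windows

end Summit.NavierStokesRegularity.NavierStokesRegularity.Theorems.ScenarioCensus.VanishingTop

end
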